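import Summits.ResolutionOfSingularities.ResolutionOfSingularities.Theorems.WildPurityWildSymbolFrobeniusBlind
import HarnessLib

/-!
# `WildSymbol` (stmt-ResolutionOfSingularities-17133), line `birth` — the FROBENIUS-SANDWICH form
# of the crux: `¬ (sandwich purity) → WildSymbol` (and `¬ WildSymbol → sandwich purity`)

Support file for crux #2 of route `ResolutionOfSingularities/WildPurity`
(`Summit.ResolutionOfSingularities.ResolutionOfSingularities.Theses.WildPurity.WildSymbol`), line `birth`
(definitions `Theorems/WildPurityWildSymbolBirthDefs.lean`; Frobenius-blindness of (D):
`Theorems/WildPurityWildSymbolFrobeniusBlind.lean`).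

## The statement "sandwich purity" (written out INLINE in both theorems; this file declares no definition)

VALUATIVE PURITY FOR KATO'S `H³_p` OVER FROBENIUS SANDWICHES OF REGULAR GERMS: for `p` prime, `k` perfect
of characteristic `p`, `K/k` finitely generated, `O ⊇ k` a valuation ring of `K` and `B ⊆ O` a finitely
generated `k`-subalgebra such that
* `K` is `p`-RADICAL over `Frac B` (`x^{p^e} ∈ Frac B` for all `x ∈ K`, one `e`), and
* the local ring of the point `locAt B O = B_{𝔪_O ∩ B} ⊆ K` is a REGULAR local ring,
every class `α ∈ H³_p(K) = G ⧸ N` satisfying the crux's condition (D) with respect to the model `B`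
(`α` integral at every divisorial `W ⊇ B` centred inside the centre of `O`, equivalently at every
divisorial `W ⊇ locAt B O`) is `O`-integral. The normalisation `Ã` of `A₀ := locAt B O` in `K` is a
"Frobenius sandwich" `A₀ ⊆ Ã ⊆ A₀^{1/p^e}` — the normalised iterated `μ_p/α_p`-cover `z^{p} = f` of a
regular germ, equivalently the ring of constants of a `p`-closed foliation on a regular germ — and the
divisorial `W ⊇ A₀` are exactly the prime divisors of `K` centred on `Spec Ã`; so sandwich purity says:
a class unramified on the whole Riemann–Zariski space over a Frobenius sandwich is integral at every
valuation dominating it. It is NOT a published theorem and NOT claimed here: it is the precise open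
statement to which the crux reduces (lead's notes `Cruxes/WildSymbol/NOTES.md`, §Sandwich reduction;
Temkin, arXiv:0804.1554, Remark 1.5 (ii)–(iii), isolates the same residual problem for local
uniformization itself: "uniformize valuations on `μ_p`-torsors over regular schemes"):

* `¬ (sandwich purity) → WildSymbol` — PROVED below, unconditionally and elementarily
  (`wildSymbol_of_not_sandwichPurity`): a failure of sandwich purity IS a witness of the crux, with the
  affine model `R := B[x₁s₁, …, xₘsₘ]` (field generators `xᵢ ∈ O` of `K/k` made `p`-radical over `B`
  by denominators `sᵢ ∈ B`), because the test class of (D) is blind to `p`-radical enlargements of the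
  model (`divIntegral_iff_of_pRadical`). Regularity of `locAt B O` is not even used.
* `WildSymbol → ¬ (sandwich purity)` — holds MODULO Temkin's inseparable local uniformization
  (arXiv:0804.1554, Thm. 1.2 = the tree's `Temkin2013Relative`, with Remark 1.5 (i): the Frobenius
  image `A₀ = Nr_L(X')_𝔭^{p^n} ⊆ K` of the regular centre is regular, essentially of finite type over
  `k`, contains `R^{p^n}`, is dominated by `O`, and `K` is `p`-radical over `Frac A₀`); paper proof in
  the crux notes, formalisation deferred (it needs the transport of `IsRegularLocalRing` along
  `IsPurelyInseparable.iterateFrobenius`).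

Hence, given Temkin 2013: `WildSymbol ↔ ¬ (sandwich purity)`, and `¬ WildSymbol` ("valuative purity for
`H³_p` without resolution") is EXACTLY sandwich purity. For `H¹_p` (Artin–Schreier classes) the analogue
of sandwich purity holds (Frobenius `f ↦ f^{p^n}` is the identity on `K/℘K` and carries `K` into
`Frac A₀`; constant coefficients descend along the universal homeomorphism `Spec Ã → Spec A₀`); for
`H^{q+1}_p`, `q ≥ 1`, the sheaf `Ω^q_log` is not topological and no such descent is known — this is the
whole residual difficulty of the crux, and where any witness must live (trdeg `≥ 4`, `O` a defect place
not uniformizable over `Ã`).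

Contents: `wildSymbol_intro`, `sandwichPurity_of_not_wildSymbol`, `wildSymbol_of_not_sandwichPurity` (no definition).
-/

noncomputable section

-- single-problem summit: the doubled namespace component `ResolutionOfSingularities` is forced
set_option linter.dupNamespace false

namespace Summit.ResolutionOfSingularities.ResolutionOfSingularities.Theorems.WildSymbol.Birth

open Summit.ResolutionOfSingularities.ResolutionOfSingularities.Theses.WildPurity (WildSymbol)

/-- Repacking a witness given over the named pieces (`G`, `N`, `Unr`, `DivIntegral`) into the crux. [folklore] -/
theorem wildSymbol_intro (p : ℕ) (hp : p.Prime) (k K : Type) [ik : Field k] [icp : CharP k p]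
    [ipf : PerfectField k] [iK : Field K] [ialg : Algebra k K] (hfg : (⊤ : IntermediateField k K).FG)
    (O : ValuationSubring K) (hO : ∀ c : k, algebraMap k K c ∈ O) (R : Subalgebra k K) (hR : R.FG)
    (hRO : R.toSubring ≤ O.toSubring) (hfr : IsFractionRing R K) (α : G K ⧸ N p K)
    (hdiv : DivIntegral p k K R O α) (hα : α ∉ Unr p K O.toSubring) : WildSymbol := by
  -- the route's `let`s `G`, `N`, `Unr` and its clause (D) unfold definitionally to the named ones
  exact ⟨p, hp, k, K, ik, icp, ipf, iK, ialg, hfg, O, hO, R, hR, hRO, hfr, α, hdiv, hα⟩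

/-- **`¬ WildSymbol →` sandwich purity** (the statement of the module docstring, inline; equivalently
`wildSymbol_of_not_sandwichPurity`): a failure of sandwich purity is a witness of the crux. Given the
data `(p, k, K, O, B, e, α)` with (D) for `B` and `α ∉ Unr(O)`, choose field generators `x₁, …, xₘ` of
`K/k` inside `O` (invert those outside `O`) and denominators `sᵢ ∈ B ∖ 0` with `xᵢ^{p^e} sᵢ ∈ B`; the model
`R := B ⊔ k[x₁s₁, …, xₘsₘ] ⊆ O` is finitely generated with `Frac R = K` (`xᵢ = (xᵢsᵢ)/sᵢ`), and (D) for
`R` is (D) for `B` because `(xᵢsᵢ)^{p^e} = (xᵢ^{p^e}sᵢ)·sᵢ^{p^e-1} ∈ B ⊆ locAt B O`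
(`divIntegral_iff_of_pRadical`). Regularity of `locAt B O` is not used. [folklore] -/
theorem sandwichPurity_of_not_wildSymbol (hW : ¬ WildSymbol) :
    ∀ p : ℕ, p.Prime → ∀ (k K : Type) [Field k] [CharP k p] [PerfectField k] [Field K] [Algebra k K],
      (⊤ : IntermediateField k K).FG → ∀ O : ValuationSubring K, (∀ c : k, algebraMap k K c ∈ O) →
      ∀ B : Subalgebra k K, B.FG → B.toSubring ≤ O.toSubring →
      (∃ e : ℕ, ∀ x : K, ∃ y s : K, y ∈ B ∧ s ∈ B ∧ s ≠ 0 ∧ x ^ (p ^ e) * s = y) →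
      IsRegularLocalRing (locAt (B : Set K) O) →
      ∀ α : G K ⧸ N p K, DivIntegral p k K B O α → α ∈ Unr p K O.toSubring := by
  intro p hp k K _ _ _ _ _ hfg O hO B hB hBO hrad _hreg α hdiv
  classical
  obtain ⟨e, hrad⟩ := hrad
  by_contra hα
  apply hW
  haveI : Fact p.Prime := ⟨hp⟩
  haveI : CharP K p := charP_of_injective_algebraMap (algebraMap k K).injective p
  -- field generators of `K/k`, moved inside `O`
  obtain ⟨t, ht⟩ := id hfg
  let f : K → K := fun x => if x ∈ O then x else x⁻¹
  have hfO : ∀ x : K, f x ∈ O := by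
    intro x
    by_cases hx : x ∈ O
    · simp [f, hx]
    · simpa [f, hx] using (O.mem_or_inv_mem x).resolve_left hx
  -- denominators in `B` making the generators `p`-radical over `B`
  choose y s hy hs hs0 hys using hrad
  let g : K → K := fun x => f x * s (f x)
  let T : Set K := ((t.image g : Finset K) : Set K)
  let R : Subalgebra k K := B ⊔ Algebra.adjoin k T
  -- `O` as a `k`-subalgebra
  let Oalg : Subalgebra k K := { O.toSubring with algebraMap_mem' := hO }
  have hBO' : B ≤ Oalg := fun x hx => hBO hx
  have hTO : T ⊆ (Oalg : Set K) := by
    intro z hz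
    obtain ⟨x, -, rfl⟩ := Finset.mem_image.mp (Finset.mem_coe.mp hz)
    exact O.mul_mem _ _ (hfO x) (hBO (hs (f x)))
  have hRO : R ≤ Oalg := sup_le hBO' (Algebra.adjoin_le hTO)
  -- the `p^e`-th powers of the new generators lie in `B ⊆ locAt B O`
  have hT : ∀ z ∈ T, z ^ (p ^ e) ∈ locAt (B : Set K) O := by
    intro z hz
    obtain ⟨x, -, rfl⟩ := Finset.mem_image.mp (Finset.mem_coe.mp hz)
    have hpe : p ^ e = (p ^ e - 1) + 1 := (Nat.succ_pred_eq_of_pos (pow_pos hp.pos e)).symm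
    have key : g x ^ (p ^ e) = y (f x) * s (f x) ^ (p ^ e - 1) :=
      calc g x ^ (p ^ e) = f x ^ (p ^ e) * s (f x) ^ (p ^ e) := mul_pow _ _ _
        _ = f x ^ (p ^ e) * (s (f x) ^ (p ^ e - 1) * s (f x)) := by rw [← pow_succ, ← hpe]
        _ = (f x ^ (p ^ e) * s (f x)) * s (f x) ^ (p ^ e - 1) := by ring
        _ = y (f x) * s (f x) ^ (p ^ e - 1) := by rw [hys]
    rw [key]
    exact le_locAt B O (B.mul_mem (hy (f x)) (B.pow_mem (hs (f x)) _))
  -- every field generator lies in the subfield generated by `R`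
  have ht_sub : (t : Set K) ⊆ (IntermediateField.adjoin k (R : Set K) : Set K) := by
    intro x hx
    have hgx : g x ∈ IntermediateField.adjoin k (R : Set K) :=
      IntermediateField.subset_adjoin k _
        ((le_sup_right : Algebra.adjoin k T ≤ R)
          (Algebra.subset_adjoin (Finset.mem_coe.mpr (Finset.mem_image_of_mem g (Finset.mem_coe.mp hx)))))
    have hsx : s (f x) ∈ IntermediateField.adjoin k (R : Set K) :=
      IntermediateField.subset_adjoin k _ ((le_sup_left : B ≤ R) (hs (f x)))
    have hfx : f x ∈ IntermediateField.adjoin k (R : Set K) := by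
      have : f x = g x / s (f x) := by
        show f x = f x * s (f x) / s (f x)
        rw [mul_div_assoc, div_self (hs0 (f x)), mul_one]
      rw [this]
      exact div_mem hgx hsx
    by_cases hxO : x ∈ O
    · simpa [f, hxO] using hfx
    · have : x⁻¹ ∈ IntermediateField.adjoin k (R : Set K) := by simpa [f, hxO] using hfx
      simpa using inv_mem this
  have htop : IntermediateField.adjoin k (R : Set K) = ⊤ := by
    apply top_le_iff.mp
    rw [← ht]
    exact IntermediateField.adjoin_le_iff.mpr ht_sub
  have hfr : IsFractionRing R K := by
    refine IsFractionRing.of_field R K fun z => ?_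
    have hz : z ∈ IntermediateField.adjoin k (R : Set K) := by rw [htop]; trivial
    obtain ⟨a, ha, b, hb, rfl⟩ := IntermediateField.mem_adjoin_iff_div.mp hz
    rw [Algebra.adjoin_eq] at ha hb
    exact ⟨⟨a, ha⟩, ⟨b, hb⟩, rfl⟩
  have hdivR : DivIntegral p k K R O α := (divIntegral_iff_of_pRadical p B O α T e hT).mp hdiv
  have hRfg : R.FG := hB.sup (Subalgebra.fg_adjoin_finset (t.image g))
  have hRO' : R.toSubring ≤ O.toSubring := fun x hx => hRO hx
  exact wildSymbol_intro p hp k K hfg O hO R hRfg hRO' hfr α hdivR hα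

/-- **`¬` (sandwich purity) `→ WildSymbol`**: a class unramified on the Riemann–Zariski space over a
Frobenius sandwich of a regular germ but non-integral at a dominating valuation IS a witness of the crux
(contrapositive of `sandwichPurity_of_not_wildSymbol`). This is the sufficient condition for the crux
that is also necessary modulo Temkin 2013 (module docstring). [folklore] -/
theorem wildSymbol_of_not_sandwichPurity (h : ¬ ∀ p : ℕ, p.Prime → ∀ (k K : Type) [Field k] [CharP k p] [PerfectField k] [Field K] [Algebra k K],
      (⊤ : IntermediateField k K).FG → ∀ O : ValuationSubring K, (∀ c : k, algebraMap k K c ∈ O) →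
      ∀ B : Subalgebra k K, B.FG → B.toSubring ≤ O.toSubring →
      (∃ e : ℕ, ∀ x : K, ∃ y s : K, y ∈ B ∧ s ∈ B ∧ s ≠ 0 ∧ x ^ (p ^ e) * s = y) →
      IsRegularLocalRing (locAt (B : Set K) O) →
      ∀ α : G K ⧸ N p K, DivIntegral p k K B O α → α ∈ Unr p K O.toSubring) :
    WildSymbol := by
  by_contra hW
  exact h (sandwichPurity_of_not_wildSymbol hW)

end Summit.ResolutionOfSingularities.ResolutionOfSingularities.Theorems.WildSymbol.Birth

end
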